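/-
Copyright (c) 2026. All rights reserved.
Released under Apache 2.0 license as described in the file LICENSE.
Authors: abc-iut cell, seat abc-iut-L4-t14 (wave 2).
-/
import Literature.AnabelianGeometry.AbsoluteAnabelian.HolomorphicCores
import Literature.Analysis.Complex.InjectiveHolomorphic
import HarnessLib

/-!
# [AbsTopIII] Cor 2.4 (b), first half: deck transformations of a holomorphic covering are
# holomorphic automorphisms — proof

Proof-only companion of `HolomorphicCores.lean` (S. Mochizuki, *Topics in absolute anabelian
geometry III*, [MochizukiAbsTopIII2015], Cor 2.4 (b) p.54 of the kurims manuscript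
`paper:url-5493eb38cbb7`: "we obtain a natural injection `π₁(X^top) = Aut(U^top/X^top) ↪ Aut⁰(𝕌) ⊆ Aut(𝕌)`").
The named fact `DeckGroupInAutIdComponent` of that file asserts `deckGroup p ⊆ Aut⁰(𝕌)`; here we
prove its FIRST HALF `deckGroup p ⊆ Aut(𝕌)`: every deck transformation `γ` of a holomorphic covering
`p : 𝕌 → X` of Riemann surfaces is a holomorphic automorphism of `𝕌` (`γ`, `γ⁻¹` are `MDifferentiable`),
hence an automorphism of the Aut-holomorphic space `𝕌 = (U^top, 𝒜)` (`autSet`).  The second half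
("`⊆ Aut⁰`", the identity component for the compact-open topology, via the Möbius form of `Aut(𝔻)`) is
not proved here.

Route: `p` is a local homeomorphism (`IsCoveringMap.isLocalHomeomorph`); near `u` one has
`γ = h⁻¹ ∘ p` for the local inverse `h⁻¹` of `p` at `γ u`; `h⁻¹` is holomorphic by the holomorphic
inverse-function theorem (the tree's `Literature.Analysis.Complex.SCV.differentiableOn_symm_of_differentiableOn`,
Fritzsche–Grauert I.8.6, read in charts via `mdifferentiableAt_iff_of_mem_source`); holomorphic maps
between open subsets transport `Aut^hol` by conjugation (the `LiftProp` subtype lemmas).  No new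
definitions; nothing here bears on [IUTchIII] Cor. 3.12.
-/

noncomputable section

open scoped Manifold ContDiff Topology
open TopologicalSpace Set

namespace Literature.AnabelianGeometry.AbsoluteAnabelian

universe u

section Inverse

variable {M : Type u} [TopologicalSpace M] [ChartedSpace ℂ M] [IsManifold 𝓘(ℂ, ℂ) ω M]
  {N : Type u} [TopologicalSpace N] [ChartedSpace ℂ N] [IsManifold 𝓘(ℂ, ℂ) ω N]

/-- **Holomorphic inverse function theorem on Riemann surfaces, local-homeomorphism form**: the inverse
of a holomorphic open partial homeomorphism between Riemann surfaces is holomorphic (via the chart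
expression and Fritzsche–Grauert I.8.6 as proved in the tree). [cite: FritzscheGrauert2002, Ch. I §8 Cor. 8.6] -/
theorem mdifferentiableAt_symm_of_mdifferentiable (h : OpenPartialHomeomorph M N)
    (hd : ∀ u ∈ h.source, MDifferentiableAt 𝓘(ℂ, ℂ) 𝓘(ℂ, ℂ) h u) {x : N} (hx : x ∈ h.target) :
    MDifferentiableAt 𝓘(ℂ, ℂ) 𝓘(ℂ, ℂ) h.symm x := by
  set v := h.symm x with hv_def
  have hv : v ∈ h.source := h.map_target hx
  -- the chart expression of `h` around `v ↦ x`, as an open partial homeomorphism of `ℂ`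
  set cU : OpenPartialHomeomorph M ℂ := chartAt ℂ v with hcU
  set cX : OpenPartialHomeomorph N ℂ := chartAt ℂ x with hcX
  set T : OpenPartialHomeomorph ℂ ℂ := (cU.symm.trans h).trans cX with hT
  have hTfun : ∀ z, T z = cX (h (cU.symm z)) := fun z => rfl
  have hTsource : ∀ z, z ∈ T.source ↔ z ∈ cU.target ∧ cU.symm z ∈ h.source ∧
      h (cU.symm z) ∈ cX.source := by
    intro z
    simp only [hT, OpenPartialHomeomorph.trans_source, OpenPartialHomeomorph.symm_source,
      mem_inter_iff, mem_preimage, OpenPartialHomeomorph.coe_trans, Function.comp_apply]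
    tauto
  -- `T` is complex-differentiable on its source (chart reading of `hd`)
  have hTd : DifferentiableOn ℂ T T.source := by
    intro z hz
    obtain ⟨hz1, hz2, hz3⟩ := (hTsource z).1 hz
    set w := cU.symm z with hw_def
    have hw : w ∈ (chartAt ℂ v).source := cU.map_target hz1
    have hmd := hd w hz2
    rw [mdifferentiableAt_iff_of_mem_source (I := 𝓘(ℂ, ℂ)) (I' := 𝓘(ℂ, ℂ)) hw hz3] at hmd
    have hzw : extChartAt 𝓘(ℂ, ℂ) v w = z := by
      rw [extChartAt_coe, Function.comp_apply, modelWithCornersSelf_coe, id]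
      exact cU.right_inv hz1
    have h2 := hmd.2
    rw [hzw, ModelWithCorners.Boundaryless.range_eq_univ, differentiableWithinAt_univ] at h2
    have hfun : (extChartAt 𝓘(ℂ, ℂ) x ∘ h ∘ (extChartAt 𝓘(ℂ, ℂ) v).symm) = T := by
      funext z
      simp only [Function.comp_apply, extChartAt_coe, extChartAt_coe_symm, modelWithCornersSelf_coe,
        modelWithCornersSelf_coe_symm, id, hTfun, hcU, hcX]
    rw [hfun] at h2
    exact h2.differentiableWithinAt
  -- hence its inverse is complex-differentiable on the target (Fritzsche–Grauert I.8.6)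
  have hTsymm : DifferentiableOn ℂ T.symm T.target :=
    Literature.Analysis.Complex.SCV.differentiableOn_symm_of_differentiableOn rfl T hTd
  -- the point `cX x` lies in the (open) target of `T`
  have hxT : cX x ∈ T.target := by
    have : cX x = T (cU v) := by
      rw [hTfun, cU.left_inv (mem_chart_source ℂ v), hv_def, h.right_inv hx]
    rw [this]
    exact T.map_source ((hTsource _).2 ⟨cU.map_source (mem_chart_source ℂ v),
      by rw [cU.left_inv (mem_chart_source ℂ v)]; exact hv,
      by rw [cU.left_inv (mem_chart_source ℂ v), hv_def, h.right_inv hx]; exact mem_chart_source ℂ x⟩)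
  have hdiffAt : DifferentiableAt ℂ T.symm (cX x) :=
    (hTsymm _ hxT).differentiableAt (T.open_target.mem_nhds hxT)
  -- read back through the charts at `x ↦ v`
  rw [mdifferentiableAt_iff_of_mem_source (I := 𝓘(ℂ, ℂ)) (I' := 𝓘(ℂ, ℂ)) (mem_chart_source ℂ x)
    (by rw [← hv_def]; exact mem_chart_source ℂ v)]
  refine ⟨h.continuousAt_symm hx, ?_⟩
  rw [ModelWithCorners.Boundaryless.range_eq_univ, differentiableWithinAt_univ]
  have hfun : (extChartAt 𝓘(ℂ, ℂ) v ∘ h.symm ∘ (extChartAt 𝓘(ℂ, ℂ) x).symm) = T.symm := by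
    funext z
    simp only [Function.comp_apply, extChartAt_coe, extChartAt_coe_symm, modelWithCornersSelf_coe,
      modelWithCornersSelf_coe_symm, id, hT, hcU, hcX, OpenPartialHomeomorph.coe_trans_symm,
      OpenPartialHomeomorph.symm_symm]
  have hpt : extChartAt 𝓘(ℂ, ℂ) x x = cX x := by
    rw [extChartAt_coe, Function.comp_apply, modelWithCornersSelf_coe, id]
  rw [hfun, hpt]
  exact hdiffAt

end Inverse

section Deck

variable {X : Type u} [TopologicalSpace X] [ChartedSpace ℂ X] [IsManifold 𝓘(ℂ, ℂ) ω X]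
  {Ucov : Type u} [TopologicalSpace Ucov] [ChartedSpace ℂ Ucov] [IsManifold 𝓘(ℂ, ℂ) ω Ucov]
  {p : Ucov → X}

/-- **Deck transformations of a holomorphic covering are holomorphic**: if `p : 𝕌 → X` is a covering map
between Riemann surfaces which is holomorphic, then every `γ ∈ Aut(U^top/X^top)` is holomorphic
(locally `γ = h⁻¹ ∘ p` for a local inverse `h⁻¹` of `p`). [cite: MochizukiAbsTopIII2015, Corollary 2.4 (b) p.54] -/
theorem mdifferentiable_of_mem_deckGroup (hp : IsCoveringMap p)
    (hpd : MDifferentiable 𝓘(ℂ, ℂ) 𝓘(ℂ, ℂ) p) {γ : Ucov ≃ₜ Ucov} (hγ : γ ∈ deckGroup p) :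
    MDifferentiable 𝓘(ℂ, ℂ) 𝓘(ℂ, ℂ) γ := by
  have hγp : ∀ y, p (γ y) = p y :=
    (Literature.Geometry.Kaehler.ComplexTorus.mem_deckTransformations_iff p γ).1 hγ
  intro u
  obtain ⟨h, hvh, hph⟩ := hp.isLocalHomeomorph (γ u)
  -- near `u`, `γ = h⁻¹ ∘ p`
  have heq : (h.symm ∘ p) =ᶠ[𝓝 u] γ := by
    have hnear : ∀ᶠ w in 𝓝 u, γ w ∈ h.source :=
      γ.continuous.continuousAt.preimage_mem_nhds (h.open_source.mem_nhds hvh)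
    filter_upwards [hnear] with w hw
    simp only [Function.comp_apply]
    rw [← hγp w, hph]
    exact h.left_inv hw
  have hsymm : MDifferentiableAt 𝓘(ℂ, ℂ) 𝓘(ℂ, ℂ) h.symm (p u) := by
    refine mdifferentiableAt_symm_of_mdifferentiable h (fun w _ => ?_) ?_
    · rw [← hph]; exact hpd w
    · rw [← hγp u, hph]; exact h.map_source hvh
  exact (hsymm.comp u (hpd u)).congr_of_eventuallyEq heq.symm

/-- Both a deck transformation and its inverse are holomorphic.
[cite: MochizukiAbsTopIII2015, Corollary 2.4 (b) p.54] -/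
theorem mdifferentiable_symm_of_mem_deckGroup (hp : IsCoveringMap p)
    (hpd : MDifferentiable 𝓘(ℂ, ℂ) 𝓘(ℂ, ℂ) p) {γ : Ucov ≃ₜ Ucov} (hγ : γ ∈ deckGroup p) :
    MDifferentiable 𝓘(ℂ, ℂ) 𝓘(ℂ, ℂ) γ.symm :=
  mdifferentiable_of_mem_deckGroup hp hpd ((deckGroup p).inv_mem hγ)

/-! ### Transport of `Aut^hol` along a holomorphic homeomorphism; deck transformations lie in `Aut(𝕌)` -/

/-- Differentiability of a map restricted to an open subset (domain side) is differentiability of the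
map. [cite: MochizukiAbsTopIII2015, Corollary 2.4 (b) p.54] -/
theorem mdifferentiableAt_subtype_iff {M : Type u} [TopologicalSpace M] [ChartedSpace ℂ M]
    {M' : Type u} [TopologicalSpace M'] [ChartedSpace ℂ M'] {U : Opens M} {f : M → M'} {x : U} :
    MDifferentiableAt 𝓘(ℂ, ℂ) 𝓘(ℂ, ℂ) (fun x : U => f x) x ↔ MDifferentiableAt 𝓘(ℂ, ℂ) 𝓘(ℂ, ℂ) f x :=
  ((differentiableWithinAt_localInvariantProp (I := 𝓘(ℂ, ℂ)) (I' := 𝓘(ℂ, ℂ))).liftPropAt_iff_comp_subtype_val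
    _ _).symm

/-- Differentiability of a map into an open subset (codomain side) is differentiability of the
composite with the inclusion. [cite: MochizukiAbsTopIII2015, Corollary 2.4 (b) p.54] -/
theorem mdifferentiableAt_subtypeVal_comp_iff {M : Type u} [TopologicalSpace M] [ChartedSpace ℂ M]
    {M' : Type u} [TopologicalSpace M'] [ChartedSpace ℂ M'] (U : Opens M') (f : M → U) (x : M) :
    MDifferentiableAt 𝓘(ℂ, ℂ) 𝓘(ℂ, ℂ) (Subtype.val ∘ f) x ↔ MDifferentiableAt 𝓘(ℂ, ℂ) 𝓘(ℂ, ℂ) f x :=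
  ChartedSpace.liftPropWithinAt_subtypeVal_comp_iff ..

/-- A map between open subsets of Riemann surfaces whose composite with the inclusions is a
holomorphic map of the ambient surfaces is holomorphic. [cite: MochizukiAbsTopIII2015, Corollary 2.4 (b) p.54] -/
theorem mdifferentiable_opens_of_val_eq {M : Type u} [TopologicalSpace M] [ChartedSpace ℂ M]
    {U V : Opens M} {g : M → M} (hg : MDifferentiable 𝓘(ℂ, ℂ) 𝓘(ℂ, ℂ) g) (e : U → V)
    (he : ∀ x : U, (e x : M) = g x) : MDifferentiable 𝓘(ℂ, ℂ) 𝓘(ℂ, ℂ) e := by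
  intro x
  rw [← mdifferentiableAt_subtypeVal_comp_iff]
  have : (Subtype.val ∘ e) = fun x : U => g x := funext fun x => he x
  rw [this, mdifferentiableAt_subtype_iff]
  exact hg x

/-- **Transport of `Aut^hol` by conjugation**: if the homeomorphism `e : U ≃ₜ V` between open subsets of
a Riemann surface is the restriction of a biholomorphic `γ`, conjugation by `e` carries `Aut^hol(U)` onto
`Aut^hol(V)`. [cite: MochizukiAbsTopIII2015, Corollary 2.4 (b) p.54] -/
theorem holAut_map_homeoConj_of_restrict {M : Type u} [TopologicalSpace M] [ChartedSpace ℂ M]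
    {U V : Opens M} (γ : M ≃ₜ M) (hγ : MDifferentiable 𝓘(ℂ, ℂ) 𝓘(ℂ, ℂ) γ)
    (hγ' : MDifferentiable 𝓘(ℂ, ℂ) 𝓘(ℂ, ℂ) γ.symm) (e : U ≃ₜ V) (he : ∀ x : U, (e x : M) = γ x) :
    (holAut U).map (homeoConj e).toMonoidHom = holAut V := by
  have he' : ∀ y : V, (e.symm y : M) = γ.symm y := by
    intro y
    apply γ.injective
    rw [γ.apply_symm_apply, ← he, e.apply_symm_apply]
  have hme : MDifferentiable 𝓘(ℂ, ℂ) 𝓘(ℂ, ℂ) e := mdifferentiable_opens_of_val_eq hγ e he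
  have hme' : MDifferentiable 𝓘(ℂ, ℂ) 𝓘(ℂ, ℂ) e.symm := mdifferentiable_opens_of_val_eq hγ' e.symm he'
  ext χ
  rw [Subgroup.mem_map_equiv]
  simp only [mem_holAut_iff]
  constructor
  · rintro ⟨h1, h2⟩
    -- χ = e ∘ (e⁻¹ χ e) ∘ e⁻¹
    refine ⟨?_, ?_⟩
    · have : ⇑χ = e ∘ ((homeoConj e).symm χ) ∘ e.symm := by
        ext y; simp [homeoConj]
      rw [this]; exact (hme.comp h1).comp hme'
    · have : ⇑χ.symm = e ∘ ((homeoConj e).symm χ).symm ∘ e.symm := by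
        ext y; simp [homeoConj]
      rw [this]; exact (hme.comp h2).comp hme'
  · rintro ⟨h1, h2⟩
    refine ⟨?_, ?_⟩
    · have : ⇑((homeoConj e).symm χ) = e.symm ∘ χ ∘ e := by
        ext y; simp [homeoConj]
      rw [this]; exact (hme'.comp h1).comp hme
    · have : ⇑((homeoConj e).symm χ).symm = e.symm ∘ χ.symm ∘ e := by
        ext y; simp [homeoConj]
      rw [this]; exact (hme'.comp h2).comp hme

/-- A biholomorphic self-homeomorphism of a Riemann surface is a morphism of its Aut-holomorphic space
(Def 2.1 (ii): it transports `Aut^hol(U_X)` onto `Aut^hol(U_Y)` for every connected open mapped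
homeomorphically). [cite: MochizukiAbsTopIII2015, Definition 2.1 (ii) p.51] -/
theorem isMorphism_ofCharted_of_mdifferentiable {M : Type u} [TopologicalSpace M] [ChartedSpace ℂ M]
    (γ : M ≃ₜ M) (hγ : MDifferentiable 𝓘(ℂ, ℂ) 𝓘(ℂ, ℂ) γ) (hγ' : MDifferentiable 𝓘(ℂ, ℂ) 𝓘(ℂ, ℂ) γ.symm) :
    IsMorphism (AutHolStructure.ofCharted M) (AutHolStructure.ofCharted M) γ where
  isLocalHomeomorph := γ.isLocalHomeomorph
  map_aut_eq := by
    intro U V _ _ e he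
    rw [AutHolStructure.ofCharted_aut, AutHolStructure.ofCharted_aut]
    exact holAut_map_homeoConj_of_restrict γ hγ hγ' e he

/-- **[AbsTopIII] Cor 2.4 (b), first half — PROVED**: the deck transformations of a holomorphic covering
`p : 𝕌 → X` of Riemann surfaces lie in `Aut(𝕌)`, the automorphisms of the Aut-holomorphic space of `𝕌`
("`π₁(X^top) = Aut(U^top/X^top) ↪ … ⊆ Aut(𝕌)`"; the identity-component refinement `⊆ Aut⁰(𝕌)` of
`DeckGroupInAutIdComponent` is not proved here). [cite: MochizukiAbsTopIII2015, Corollary 2.4 (b) p.54] -/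
theorem deckGroup_subset_autSet (hp : IsCoveringMap p) (hpd : MDifferentiable 𝓘(ℂ, ℂ) 𝓘(ℂ, ℂ) p) :
    ((deckGroup p : Subgroup (Ucov ≃ₜ Ucov)) : Set (Ucov ≃ₜ Ucov)) ⊆
      autSet (AutHolStructure.ofCharted Ucov) := by
  intro γ hγ
  have h1 := mdifferentiable_of_mem_deckGroup hp hpd hγ
  have h2 := mdifferentiable_symm_of_mem_deckGroup hp hpd hγ
  exact ⟨isMorphism_ofCharted_of_mdifferentiable γ h1 h2,
    isMorphism_ofCharted_of_mdifferentiable γ.symm h2 (by simpa using h1)⟩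


/-- A biholomorphic self-homeomorphism of a Riemann surface lies in `Aut(𝕏)` (= `autSet` of the
Aut-holomorphic structure of the surface): both it and its inverse are morphisms.  (Name requested by
seat abc-iut-L4-t8 for the identity-component half of Cor 2.4 (b).)
[cite: MochizukiAbsTopIII2015, Corollary 2.4 (b) p.54] -/
theorem mem_autSet_ofCharted_of_mdifferentiable {M : Type u} [TopologicalSpace M] [ChartedSpace ℂ M]
    (γ : M ≃ₜ M) (hγ : MDifferentiable 𝓘(ℂ, ℂ) 𝓘(ℂ, ℂ) γ) (hγ' : MDifferentiable 𝓘(ℂ, ℂ) 𝓘(ℂ, ℂ) γ.symm) :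
    γ ∈ autSet (AutHolStructure.ofCharted M) :=
  ⟨isMorphism_ofCharted_of_mdifferentiable γ hγ hγ',
    isMorphism_ofCharted_of_mdifferentiable γ.symm hγ' (by simpa using hγ)⟩

end Deck

end Literature.AnabelianGeometry.AbsoluteAnabelian

end
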